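import Mathlib

/-!
# «No DESIGN-16» for every κ and every unit phase — kernel companions (hsemireg-semihom-2 g24, 2026-08-31)

line stmt-HodgeConjecture-18881 Cruxes/BlochSeedDiscOne/Lines/birth.lean 814a6a70c14e831a stub_rung_pad4_seedAt —
stub untouched; NOTHING in this file is proved toward HC ∕ HC_CM ∕ HC_AV ∕ №4 ∕ 26512 ∕ 18881 ∕ 30548 ∕ (H2).
Designs ≠ sheaves ≠ SEED.  This file kernel-checks the finite algebraic identities that carry the memo
`Cruxes/BlochSeedDiscOne/NO-DESIGN16-ALLPHASES-U2-semihom2-g24.md` (director menu P5, R19.656(2)/R19.658(8)):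

THEOREM (memo §1; pen + exhaustive phase-free enumeration, hub-local stdlib Python). In the two-height box alphabet
`𝔄_κ = {A·I ⊕_g [[σ_g t, c φ_g],[c φ̄_g, σ_g t]] : σ ∈ {±1}⁴, φ_g ∈ U(1)}` (t, c > 0 fixed, κ := 1 − c²/t² ≠ 1, arbitrary positive
weights, ARBITRARY unit phases) every (A1)-clean charged design has support ≥ 17.  (g22 R5 had this for κ = 0 and φ_g ∈ μ₄ only.)

What is checked HERE (sorry-free, axioms standard):
* §P5b  the class values of the σ-marginal `16·p_*` synthesised from the Walsh data `(1, m, κ, κm, κ²)`, their total mass 16,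
        `B₊ = 0 ∧ κ ≠ 1 ⇒ A₊ = −(1−κ)² < 0… ≤ 0`, and `A₊ = A₋ = 0 ⇒ m(1+κ) = 0 ∧ κ²+6κ+1 = 0`, `κ = −1` excluded;
* §P5a  LEMMA S families: the M-type slice identity (cubic = z·Σ_{s₃} s₃ Δx Δy, killed by the OR conditions) and the DIAG
        slice family (cubic vanishes identically); the factorisation of the top form `Σ_l (Π sg lᵢ) Π uᵢ(lᵢ) = Π (uᵢ ⊤ − uᵢ ⊥)`;
        and, by `decide`, that the label maps of the two maximal (C2)+(C3)-families with non-vanishing top form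
        (the 4-CYCLE family and the MAJORITY family, `out/p5a_maxfamilies.json`) are parity-preserving bijections of `Bool⁴`
        — hence on both families every top sum, pure or mixed, equals `Π_a (u_a⁰)^{±1} − (u_a¹)^{±1}`, whose moduli agree,
        so the mixed sums vanish iff μ does: no 16-letter design at κ = 0 for any phases.
What is NOT checked here (pen ∕ Python, see the memo): the structure theorem at s = 16, the exhaustiveness of LEMMA S
(case analysis; corroborated over μ_N, N ∈ {4,6,8,12}: 0 metric solutions) and the slice-type enumeration (11 types per slice,
8 slices; 3 leaves, 2 families up to B₄).  No `sorry`, no new axioms, no instances, no notation.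
-/

namespace Summit.HodgeConjecture.HodgeConjecture.Cruxes.BlochSeedDiscOne.NoDesign16

/-! ## §P5b — the σ-marginal at s = 16, κ ≠ 0 -/
section P5b

/-- `16·p_*(++++)`. -/
def Aplus (κ m : ℝ) : ℝ := 1 + 6*κ + κ^2 + 4*m*(1+κ)
/-- `16·p_*(−−−−)`. -/
def Aminus (κ m : ℝ) : ℝ := 1 + 6*κ + κ^2 - 4*m*(1+κ)
/-- `16·p_*` on the four classes with exactly one `−`. -/
def Bplus (κ m : ℝ) : ℝ := (1-κ)*(1+κ+2*m)
/-- `16·p_*` on the four classes with exactly one `+`. -/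
def Bminus (κ m : ℝ) : ℝ := (1-κ)*(1+κ-2*m)
/-- `16·p_*` on the six balanced classes. -/
def Cbal (κ : ℝ) : ℝ := (1-κ)^2

/-- Walsh synthesis `16 p_*(η) = Σ_S p̂(S) χ_S(η)`, `p̂(S) = 1, m, κ, κm, κ²` for `|S| = 0…4`; at `η = (++++)` the
character sums by `|S|` are `1, 4, 6, 4, 1`. -/
theorem walsh_Aplus (κ m : ℝ) : 1*1 + 4*m + 6*κ + 4*(κ*m) + 1*κ^2 = Aplus κ m := by unfold Aplus; ring
/-- at `η = (−−−−)`: `1, −4, 6, −4, 1`. -/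
theorem walsh_Aminus (κ m : ℝ) : 1*1 - 4*m + 6*κ - 4*(κ*m) + 1*κ^2 = Aminus κ m := by unfold Aminus; ring
/-- at `η = (+++−)`: `1, 2, 0, −2, −1`. -/
theorem walsh_Bplus (κ m : ℝ) : 1*1 + 2*m + 0*κ - 2*(κ*m) - 1*κ^2 = Bplus κ m := by unfold Bplus; ring
/-- at `η = (+−−−)`: `1, −2, 0, 2, −1`. -/
theorem walsh_Bminus (κ m : ℝ) : 1*1 - 2*m + 0*κ + 2*(κ*m) - 1*κ^2 = Bminus κ m := by unfold Bminus; ring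
/-- at `η = (++−−)`: `1, 0, −2, 0, 1`. -/
theorem walsh_Cbal (κ m : ℝ) : 1*1 + 0*m - 2*κ + 0*(κ*m) + 1*κ^2 = Cbal κ := by unfold Cbal; ring

/-- total mass: `1·A₊ + 1·A₋ + 4·B₊ + 4·B₋ + 6·C = 16`. -/
theorem total_mass (κ m : ℝ) :
    Aplus κ m + Aminus κ m + 4 * Bplus κ m + 4 * Bminus κ m + 6 * Cbal κ = 16 := by
  unfold Aplus Aminus Bplus Bminus Cbal; ring

/-- the balanced classes always carry mass when `κ ≠ 1`. -/
theorem Cbal_pos {κ : ℝ} (h1 : κ ≠ 1) : 0 < Cbal κ := by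
  unfold Cbal; have : (1 - κ) ≠ 0 := sub_ne_zero.mpr (Ne.symm h1); positivity

/-- `B₊ = 0`, `κ ≠ 1` forces `A₊ = −(1−κ)²` (hence `< 0`: a one-minus class can never be empty). -/
theorem Aplus_of_Bplus_zero {κ m : ℝ} (h1 : κ ≠ 1) (h : Bplus κ m = 0) : Aplus κ m = -(1-κ)^2 := by
  unfold Bplus at h
  have hk : (1 - κ) ≠ 0 := sub_ne_zero.mpr (Ne.symm h1)
  have h' : 1 + κ + 2*m = 0 := by
    rcases mul_eq_zero.mp h with h0 | h0
    · exact absurd h0 hk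
    · exact h0
  unfold Aplus; linear_combination (2*(1+κ)) * h'

theorem Aplus_neg_of_Bplus_zero {κ m : ℝ} (h1 : κ ≠ 1) (h : Bplus κ m = 0) : Aplus κ m < 0 := by
  rw [Aplus_of_Bplus_zero h1 h]
  have : (1 - κ) ≠ 0 := sub_ne_zero.mpr (Ne.symm h1)
  have : 0 < (1-κ)^2 := by positivity
  linarith

/-- symmetric statement: `B₋ = 0`, `κ ≠ 1` forces `A₋ = −(1−κ)² < 0`. -/
theorem Aminus_of_Bminus_zero {κ m : ℝ} (h1 : κ ≠ 1) (h : Bminus κ m = 0) : Aminus κ m = -(1-κ)^2 := by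
  unfold Bminus at h
  have hk : (1 - κ) ≠ 0 := sub_ne_zero.mpr (Ne.symm h1)
  have h' : 1 + κ - 2*m = 0 := by
    rcases mul_eq_zero.mp h with h0 | h0
    · exact absurd h0 hk
    · exact h0
  unfold Aminus; linear_combination (2*(1+κ)) * h'

/-- both extreme classes empty ⇒ `m(1+κ) = 0` and `κ² + 6κ + 1 = 0`. -/
theorem extremes_zero {κ m : ℝ} (hA : Aplus κ m = 0) (hA' : Aminus κ m = 0) :
    m * (1 + κ) = 0 ∧ κ^2 + 6*κ + 1 = 0 := by
  unfold Aplus at hA; unfold Aminus at hA'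
  constructor
  · linear_combination (hA - hA') / 8
  · linear_combination (hA + hA') / 2

/-- … and then `m = 0` (the root `κ = −1` of `m(1+κ) = 0` is not a root of `κ²+6κ+1`). -/
theorem extremes_zero_m {κ m : ℝ} (hA : Aplus κ m = 0) (hA' : Aminus κ m = 0) : m = 0 := by
  obtain ⟨h1, h2⟩ := extremes_zero hA hA'
  rcases mul_eq_zero.mp h1 with h | h
  · exact h
  · exfalso; have : κ = -1 := by linarith
    subst this; norm_num at h2

/-- exactly one extreme class empty is impossible when `m = 0`; conversely `A₊ = A₋` iff `m(1+κ) = 0`. -/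
theorem Aplus_sub_Aminus (κ m : ℝ) : Aplus κ m - Aminus κ m = 8 * m * (1 + κ) := by
  unfold Aplus Aminus; ring

/-- counting behind the contradiction: 15 occupied classes of which at least 4 are doubled need ≥ 19 > 16 letters;
14 occupied classes of which 8 are doubled need ≥ 22 > 16. -/
theorem count_one_extreme_empty : 15 + 4 > 16 ∧ 14 + 8 > 16 := by decide

end P5b

/-! ## §P5a — LEMMA S families and the top form -/
section P5a

variable {R : Type*} [CommRing R]

/-- sign of a Boolean coordinate (`true = +`). -/
def sg (b : Bool) : R := if b then 1 else -1

/-- M-type slice (`z` constant on the slice): the cubic block collapses to `z · Σ_{s₃} s₃ Δx(s₃) Δy(s₃)`, and each summand is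
killed by the OR condition `Δx(s₃)·Δy(s₃) = 0` of the pair — so M-type slices solve (C3). -/
theorem M_slice_identity (x y : Bool → Bool → R) (z : R) :
    (∑ s₁ : Bool, ∑ s₂ : Bool, ∑ s₃ : Bool, sg s₁ * sg s₂ * sg s₃ * x s₂ s₃ * y s₁ s₃ * z)
      = z * ∑ s₃ : Bool, sg s₃ * ((x true s₃ - x false s₃) * (y true s₃ - y false s₃)) := by
  simp only [Fintype.sum_bool, sg]; simp; ring

theorem M_slice_solves (x y : Bool → Bool → R) (z : R)
    (hOR : ∀ s₃ : Bool, (x true s₃ - x false s₃) * (y true s₃ - y false s₃) = 0) :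
    (∑ s₁ : Bool, ∑ s₂ : Bool, ∑ s₃ : Bool, sg s₁ * sg s₂ * sg s₃ * x s₂ s₃ * y s₁ s₃ * z) = 0 := by
  rw [M_slice_identity]; simp [hOR]

/-- the DIAG slice family of LEMMA S: `x` special at `(s₂,s₃) = (+,+)`, `y` special at `(s₁,s₃) = (+,−)`,
`z` special at `(s₁,s₂) = (−,−)` (the other 7 variants are its images under sign flips). -/
def xD (ξ₀ ξ₁ : R) (s₂ s₃ : Bool) : R := if s₂ && s₃ then ξ₀ else ξ₁
def yD (υ υ' : R) (s₁ s₃ : Bool) : R := if s₁ && !s₃ then υ' else υ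
def zD (ζ ζ' : R) (s₁ s₂ : Bool) : R := if !s₁ && !s₂ then ζ' else ζ

/-- the cubic vanishes identically on the DIAG family (all six block values free; replacing `y`, `z` by functions with
the same pattern — e.g. their conjugates — is the same statement, so every sign vector ε is covered). -/
theorem DIAG_slice_solves (ξ₀ ξ₁ υ υ' ζ ζ' : R) :
    (∑ s₁ : Bool, ∑ s₂ : Bool, ∑ s₃ : Bool,
        sg s₁ * sg s₂ * sg s₃ * xD ξ₀ ξ₁ s₂ s₃ * yD υ υ' s₁ s₃ * zD ζ ζ' s₁ s₂) = 0 := by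
  simp only [Fintype.sum_bool, sg, xD, yD, zD]; simp; ring

/-- DIAG hearing pattern: `x` hears 2 exactly at `s₃ = +` and 3 exactly at `s₂ = +` (generic values). -/
theorem DIAG_hearing (ξ₀ ξ₁ : R) (h : ξ₀ ≠ ξ₁) :
    xD ξ₀ ξ₁ true true ≠ xD ξ₀ ξ₁ false true ∧ xD ξ₀ ξ₁ true false = xD ξ₀ ξ₁ false false ∧
    xD ξ₀ ξ₁ true true ≠ xD ξ₀ ξ₁ true false ∧ xD ξ₀ ξ₁ false true = xD ξ₀ ξ₁ false false := by
  simp [xD, h]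

/-- the top form factorises: `Σ_{l ∈ Bool⁴} (Π sg lᵢ) Π uᵢ(lᵢ) = Π (uᵢ ⊤ − uᵢ ⊥)`. -/
theorem top_factorisation (u₁ u₂ u₃ u₄ : Bool → R) :
    (∑ l₁ : Bool, ∑ l₂ : Bool, ∑ l₃ : Bool, ∑ l₄ : Bool,
        sg l₁ * sg l₂ * sg l₃ * sg l₄ * u₁ l₁ * u₂ l₂ * u₃ l₃ * u₄ l₄)
      = (u₁ true - u₁ false) * (u₂ true - u₂ false) * (u₃ true - u₃ false) * (u₄ true - u₄ false) := by
  simp only [Fintype.sum_bool, sg]; simp; ring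

/-- majority of three Booleans. -/
def maj (a b c : Bool) : Bool := (a && b) || (a && c) || (b && c)

/-- label map of the 4-CYCLE family (f₁ hears only 4, f₂ only 3, f₃ only 1, f₄ only 2). -/
def cycleMap (s : Bool × Bool × Bool × Bool) : Bool × Bool × Bool × Bool :=
  (s.2.2.2, s.2.2.1, s.1, s.2.1)

/-- label map of the MAJORITY family: `(maj(s₂,s₃,s₄), maj(s₁,¬s₃,s₄), maj(s₁,s₂,¬s₄), maj(s₁,¬s₂,s₃))`. -/
def majMap (s : Bool × Bool × Bool × Bool) : Bool × Bool × Bool × Bool :=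
  (maj s.2.1 s.2.2.1 s.2.2.2, maj s.1 (!s.2.2.1) s.2.2.2, maj s.1 s.2.1 (!s.2.2.2), maj s.1 (!s.2.1) s.2.2.1)

/-- parity `s₁s₂s₃s₄` as a Boolean (`true` = `+`). -/
def parity (s : Bool × Bool × Bool × Bool) : Bool := !(xor (xor s.1 s.2.1) (xor s.2.2.1 s.2.2.2))

theorem cycleMap_bijective : Function.Bijective cycleMap := by decide
theorem majMap_bijective : Function.Bijective majMap := by decide
theorem cycleMap_parity : ∀ s, parity (cycleMap s) = parity s := by decide
theorem majMap_parity : ∀ s, parity (majMap s) = parity s := by decide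

/-- `f₁` of the MAJORITY family does not depend on `s₁`, and hears 2 exactly where `s₃ ≠ s₄` (so all four coordinates are
heard somewhere: the family is not killed by the pairing lemma, only by the modulus identity below). -/
theorem majMap_f1_hears2_iff : ∀ s : Bool × Bool × Bool × Bool,
    ((majMap s).1 ≠ (majMap (s.1, !s.2.1, s.2.2)).1) ↔ (s.2.2.1 ≠ s.2.2.2) := by decide

/-- the modulus identity that finishes P5a on both families: for unit complex numbers `u⁻¹ = ū`, so a mixed top
sum `Π_a ((u_a⁰)^{ε_a} − (u_a¹)^{ε_a})` vanishes iff the pure one (ε = ++++, = 16μ) does. -/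
theorem conj_diff_norm (u v : ℂ) : ‖(starRingEnd ℂ) u - (starRingEnd ℂ) v‖ = ‖u - v‖ := by
  rw [← map_sub, Complex.norm_conj]

theorem inv_diff_eq_zero_iff {u v : ℂ} (hu : ‖u‖ = 1) (hv : ‖v‖ = 1) :
    u⁻¹ - v⁻¹ = 0 ↔ u - v = 0 := by
  rw [Complex.inv_eq_conj hu, Complex.inv_eq_conj hv, ← map_sub, map_eq_zero]

/-- hence a product of such factors with arbitrary exponent signs vanishes iff the unsigned product does. -/
theorem signed_product_eq_zero_iff {a₀ a₁ b₀ b₁ c₀ c₁ d₀ d₁ : ℂ}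
    (ha₀ : ‖a₀‖ = 1) (ha₁ : ‖a₁‖ = 1) (hb₀ : ‖b₀‖ = 1) (hb₁ : ‖b₁‖ = 1)
    (hc₀ : ‖c₀‖ = 1) (hc₁ : ‖c₁‖ = 1) (hd₀ : ‖d₀‖ = 1) (hd₁ : ‖d₁‖ = 1) :
    (a₀ - a₁) * (b₀⁻¹ - b₁⁻¹) * (c₀⁻¹ - c₁⁻¹) * (d₀ - d₁) = 0 ↔
      (a₀ - a₁) * (b₀ - b₁) * (c₀ - c₁) * (d₀ - d₁) = 0 := by
  simp only [mul_eq_zero, inv_diff_eq_zero_iff hb₀ hb₁, inv_diff_eq_zero_iff hc₀ hc₁]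

end P5a

/-! ## σ-skeleton (g24 addendum, memo §8): coincidences of the five class values
For general support `s` the column conditions force `p_*(η) = p_*(η ⊕ e_g)` on every edge of `Q₄` whose two classes
are singletons; the resulting bound `s ≥ 16 − #empty + #D` (memo §8.2, `sigma_skeleton.py`) depends on which of the
five values `A₊, B₊, C, B₋, A₋` of adjacent levels coincide.  The lemmas below are the algebra behind the table: the
four adjacent differences, and the fact that no two of the four coincidences hold at a feasible `(κ, m) ≠ (0, 0)`. -/
section Skeleton

theorem Aplus_sub_Bplus (κ m : ℝ) : Aplus κ m - Bplus κ m = 2 * (κ^2 + 3*κ + m*(1 + 3*κ)) := by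
  simp only [Aplus, Bplus]; ring

theorem Bplus_sub_Cbal (κ m : ℝ) : Bplus κ m - Cbal κ = 2 * (1 - κ) * (κ + m) := by
  simp only [Bplus, Cbal]; ring

theorem Cbal_sub_Bminus (κ m : ℝ) : Cbal κ - Bminus κ m = -(2 * (1 - κ) * (κ - m)) := by
  simp only [Bminus, Cbal]; ring

theorem Bminus_sub_Aminus (κ m : ℝ) : Bminus κ m - Aminus κ m = -(2 * (κ^2 + 3*κ - m*(1 + 3*κ))) := by
  simp only [Aminus, Bminus]; ring

/-- e2 ∧ e3: `B₊ = C = B₋` forces the uniform point. -/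
theorem coincide_e2_e3 {κ m : ℝ} (hκ : κ ≠ 1) (h2 : Bplus κ m = Cbal κ) (h3 : Cbal κ = Bminus κ m) :
    κ = 0 ∧ m = 0 := by
  have hk : (1 - κ) ≠ 0 := sub_ne_zero.2 (Ne.symm hκ)
  have a : (1 - κ) * (2 * (κ + m)) = 0 := by
    have := Bplus_sub_Cbal κ m; linear_combination h2 - this
  have b : (1 - κ) * (2 * (κ - m)) = 0 := by
    have := Cbal_sub_Bminus κ m; linear_combination this - h3
  have a' := (mul_eq_zero.1 a).resolve_left hk
  have b' := (mul_eq_zero.1 b).resolve_left hk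
  constructor <;> linarith

/-- e1 ∧ e2: `A₊ = B₊ = C` forces the uniform point. -/
theorem coincide_e1_e2 {κ m : ℝ} (hκ : κ ≠ 1) (h1 : Aplus κ m = Bplus κ m) (h2 : Bplus κ m = Cbal κ) :
    κ = 0 ∧ m = 0 := by
  have hk : (1 - κ) ≠ 0 := sub_ne_zero.2 (Ne.symm hκ)
  have a : (1 - κ) * (2 * (κ + m)) = 0 := by
    have := Bplus_sub_Cbal κ m; linear_combination h2 - this
  have hm : m = -κ := by have := (mul_eq_zero.1 a).resolve_left hk; linarith
  have c : κ^2 + 3*κ + m*(1 + 3*κ) = 0 := by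
    have := Aplus_sub_Bplus κ m; linear_combination (h1 - this) / 2
  subst hm
  have d : κ * (1 - κ) = 0 := by linear_combination c / 2
  have := (mul_eq_zero.1 d).resolve_right hk
  constructor <;> linarith

/-- e3 ∧ e4: `C = B₋ = A₋` forces the uniform point. -/
theorem coincide_e3_e4 {κ m : ℝ} (hκ : κ ≠ 1) (h3 : Cbal κ = Bminus κ m) (h4 : Bminus κ m = Aminus κ m) :
    κ = 0 ∧ m = 0 := by
  have hk : (1 - κ) ≠ 0 := sub_ne_zero.2 (Ne.symm hκ)
  have b : (1 - κ) * (2 * (κ - m)) = 0 := by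
    have := Cbal_sub_Bminus κ m; linear_combination this - h3
  have hm : m = κ := by have := (mul_eq_zero.1 b).resolve_left hk; linarith
  have c : κ^2 + 3*κ - m*(1 + 3*κ) = 0 := by
    have := Bminus_sub_Aminus κ m; linear_combination (this - h4) / 2
  subst hm   -- eliminates κ in favour of m
  have d : m * (1 - m) = 0 := by linear_combination c / 2
  have := (mul_eq_zero.1 d).resolve_right hk
  constructor <;> linarith

/-- e1 ∧ e3: `A₊ = B₊` and `C = B₋` hold together only at the uniform point or at `κ = m = −1`, where `B₊ = −4 < 0`. -/
theorem coincide_e1_e3 {κ m : ℝ} (hκ : κ ≠ 1) (hB : 0 < Bplus κ m)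
    (h1 : Aplus κ m = Bplus κ m) (h3 : Cbal κ = Bminus κ m) : κ = 0 ∧ m = 0 := by
  have hk : (1 - κ) ≠ 0 := sub_ne_zero.2 (Ne.symm hκ)
  have b : (1 - κ) * (2 * (κ - m)) = 0 := by
    have := Cbal_sub_Bminus κ m; linear_combination this - h3
  have hm : m = κ := by have := (mul_eq_zero.1 b).resolve_left hk; linarith
  have c : κ^2 + 3*κ + m*(1 + 3*κ) = 0 := by
    have := Aplus_sub_Bplus κ m; linear_combination (h1 - this) / 2
  subst hm
  have d : m * (m + 1) = 0 := by linear_combination c / 4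
  rcases mul_eq_zero.1 d with h | h
  · exact ⟨h, h⟩
  · have hm1 : m = -1 := by linarith
    subst hm1; norm_num [Bplus] at hB

/-- e2 ∧ e4: mirror image of e1 ∧ e3 (`κ = −1, m = 1` has `B₋ = −4 < 0`). -/
theorem coincide_e2_e4 {κ m : ℝ} (hκ : κ ≠ 1) (hB : 0 < Bminus κ m)
    (h2 : Bplus κ m = Cbal κ) (h4 : Bminus κ m = Aminus κ m) : κ = 0 ∧ m = 0 := by
  have hk : (1 - κ) ≠ 0 := sub_ne_zero.2 (Ne.symm hκ)
  have a : (1 - κ) * (2 * (κ + m)) = 0 := by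
    have := Bplus_sub_Cbal κ m; linear_combination h2 - this
  have hm : κ = -m := by have := (mul_eq_zero.1 a).resolve_left hk; linarith
  have c : κ^2 + 3*κ - m*(1 + 3*κ) = 0 := by
    have := Bminus_sub_Aminus κ m; linear_combination (this - h4) / 2
  subst hm
  have d : m * (m - 1) = 0 := by linear_combination c / 4
  rcases mul_eq_zero.1 d with h | h
  · constructor <;> linarith
  · have hm1 : m = 1 := by linarith
    subst hm1; norm_num [Bminus] at hB

/-- e1 ∧ e4: `A₊ = B₊` and `B₋ = A₋` hold together only at the uniform point, at `κ = −3, m = 0` (where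
`A₊ = −8 < 0`), never at `κ = −1/3`. -/
theorem coincide_e1_e4 {κ m : ℝ} (hA : 0 ≤ Aplus κ m)
    (h1 : Aplus κ m = Bplus κ m) (h4 : Bminus κ m = Aminus κ m) : κ = 0 ∧ m = 0 := by
  have c : κ^2 + 3*κ + m*(1 + 3*κ) = 0 := by
    have := Aplus_sub_Bplus κ m; linear_combination (h1 - this) / 2
  have c' : κ^2 + 3*κ - m*(1 + 3*κ) = 0 := by
    have := Bminus_sub_Aminus κ m; linear_combination (this - h4) / 2
  have e : m * (1 + 3*κ) = 0 := by linear_combination (c - c') / 2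
  have f : κ * (κ + 3) = 0 := by linear_combination (c + c') / 2
  rcases mul_eq_zero.1 f with h | h
  · subst h
    refine ⟨rfl, ?_⟩
    simpa using e
  · have hκ3 : κ = -3 := by linarith
    subst hκ3
    have hm : m = 0 := by
      have : m * (1 + 3 * (-3 : ℝ)) = 0 := e
      have : m * (-8 : ℝ) = 0 := by linear_combination this
      simpa using this
    subst hm; norm_num [Aplus] at hA

end Skeleton

/-! ## Transfer (s = 19, configuration (c); memo §8.6)
The last 19-letter configuration at `(κ,m) = (0,0)` has two η²-letters with `(φ_{g₀}, φ_{g₁}) = (a₃,b₃), (a₄,b₄)`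
of relative weight `W ∈ (0,1)`; the class averages are `α = W a₃ + (1−W) a₄`, `β = W b₃ + (1−W) b₄` and the only
correlated average is `γ = W a₃ b₃ + (1−W) a₄ b₄` (and its conjugate variants, which are the same polynomials in the
conjugated letters since `W` is real).  The identities below are the ring-theoretic core of the TRANSFER LEMMA: after the
forced identifications `u = a₃`, `v = b₄` every corrected moment of the 19-letter design equals the plain moment of the
UNIT assignment `α ↦ a₃, β ↦ b₄`, which then contradicts THEOREM P5a (no 16-letter design). -/
section Transfer

variable {R : Type*} [CommRing R]

/-- The correlation correction: `γ − αβ = W(1−W)(a₃−a₄)(b₃−b₄)`. -/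
theorem correction_eq (W a₃ a₄ b₃ b₄ : R) :
    (W*a₃*b₃ + (1-W)*a₄*b₄) - (W*a₃ + (1-W)*a₄) * (W*b₃ + (1-W)*b₄)
      = W*(1-W)*(a₃-a₄)*(b₃-b₄) := by ring

/-- Ratio step of the corrected-OR lemma (over a field; `Q'`, `L'` play the conjugates):
`P Q = −K L`, `P Q' = −K L'`, `P ≠ 0` force `Q L' = Q' L` (so `Q conj L` is real). -/
theorem ratio_step {F : Type*} [Field F] {P Q Q' K L L' : F} (hP : P ≠ 0)
    (h1 : P*Q = -(K*L)) (h2 : P*Q' = -(K*L')) : Q*L' = Q'*L := by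
  have : P * (Q*L' - Q'*L) = 0 := by linear_combination L'*h1 - L*h2
  rcases mul_eq_zero.1 this with h | h
  · exact absurd h hP
  · exact sub_eq_zero.1 h

/-- Chord step, real core: a point `(1−t)·b₄ + t·b₃` on the chord line of two distinct unit vectors
(`r = Re(b₃ b̄₄) < 1`) has squared norm `1 − 2t(1−t)(1−r)`; it is a unit point only for `t ∈ {0,1}`. -/
theorem chord_step {t r : ℝ} (hr : r < 1) (h : 1 - 2*t*(1-t)*(1-r) = 1) : t = 0 ∨ t = 1 := by
  have : t*(1-t) = 0 := by nlinarith
  rcases mul_eq_zero.1 this with h0 | h1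
  · exact Or.inl h0
  · exact Or.inr (by linarith)

/-- The two outcomes of the corrected-OR lemma: with `β − v = t(b₃ − b₄)` and `α − u = −W(1−W)(a₃−a₄)/t`,
`t = W` gives `(u,v) = (a₃,b₄)` … -/
theorem outcome_tW (W a₃ a₄ b₃ b₄ : R) :
    (W*a₃ + (1-W)*a₄) + (1-W)*(a₃-a₄) = a₃ ∧ (W*b₃ + (1-W)*b₄) - W*(b₃-b₄) = b₄ := by
  constructor <;> ring

/-- … and `t = W − 1` gives `(u,v) = (a₄,b₃)`. -/
theorem outcome_tW1 (W a₃ a₄ b₃ b₄ : R) :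
    (W*a₃ + (1-W)*a₄) - W*(a₃-a₄) = a₄ ∧ (W*b₃ + (1-W)*b₄) - (W-1)*(b₃-b₄) = b₃ := by
  constructor <;> ring

/-- TRANSFER IDENTITY (the `W`-free miracle): in every corrected moment the η², η¹, η³ contributions combine to
`γ − α·b₄ − a₃·β`, and this equals `−a₃ b₄` = the same three contributions of the unit assignment `α ↦ a₃, β ↦ b₄`
(`a₃b₄ − a₃b₄ − a₃b₄`).  Apply with `(b₃,b₄) ↦ (b̄₃,b̄₄)` and/or `(a₃,a₄) ↦ (ā₃,ā₄)` for the conjugate classes. -/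
theorem transfer_identity (W a₃ a₄ b₃ b₄ : R) :
    (W*a₃*b₃ + (1-W)*a₄*b₄) - (W*a₃ + (1-W)*a₄)*b₄ - a₃*(W*b₃ + (1-W)*b₄) = -(a₃*b₄) := by ring

theorem transfer_identity' (W a₃ a₄ b₃ b₄ : R) :
    (W*a₃*b₃ + (1-W)*a₄*b₄) - (W*a₃ + (1-W)*a₄)*b₄ - a₃*(W*b₃ + (1-W)*b₄)
      = a₃*b₄ - a₃*b₄ - a₃*b₄ := by ring

/-- Corrected cubic of slice (4,+) = plain cubic of the transferred assignment, written out (memo §8.6 (F4)):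
with `z = c` on three cells and `ζ'` on the fourth, both bracketed coefficients agree term by term. -/
theorem corrected_cubic_transfer (W a₃ a₄ b₃ b₄ X₁ X₃ Y₁ Y₃ c ζ' : R) :
    c * ((W*a₃*b₃ + (1-W)*a₄*b₄) - (W*a₃ + (1-W)*a₄)*b₄ - a₃*(W*b₃ + (1-W)*b₄) - X₁*Y₁ + X₁*Y₃ + X₃*Y₁)
      + ζ' * (a₃*b₄ - X₃*Y₃)
    = c * (a₃*b₄ - a₃*b₄ - a₃*b₄ - X₁*Y₁ + X₁*Y₃ + X₃*Y₁) + ζ' * (a₃*b₄ - X₃*Y₃) := by ring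

/-- Chord step over `ℂ` (no real-core shortcut): if `b₃ ≠ b₄` are unit complex numbers and the real affine combination
`(1−t)·b₄ + t·b₃` is again a unit complex number, then `t = 0` or `t = 1` — a chord meets the unit circle only at its ends.
(`z * conj z = 1` encodes `‖z‖ = 1`.) -/
theorem chord_meets_circle_twice {b₃ b₄ : ℂ} {t : ℝ}
    (h3 : b₃ * (starRingEnd ℂ) b₃ = 1) (h4 : b₄ * (starRingEnd ℂ) b₄ = 1) (hne : b₃ ≠ b₄)
    (hv : ((1 - (t:ℂ)) * b₄ + t * b₃) * (starRingEnd ℂ) ((1 - (t:ℂ)) * b₄ + t * b₃) = 1) :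
    t = 0 ∨ t = 1 := by
  have hc : (starRingEnd ℂ) ((1 - (t:ℂ)) * b₄ + t * b₃)
      = (1 - (t:ℂ)) * (starRingEnd ℂ) b₄ + t * (starRingEnd ℂ) b₃ := by
    simp [map_add, map_mul, map_sub, Complex.conj_ofReal]
  rw [hc] at hv
  have key : ((t:ℂ) * (1 - t)) * ((b₃ - b₄) * ((starRingEnd ℂ) b₃ - (starRingEnd ℂ) b₄)) = 0 := by
    linear_combination (-1 : ℂ) * hv + (t:ℂ) * h3 + (1 - (t:ℂ)) * h4
  have hne' : (b₃ - b₄) * ((starRingEnd ℂ) b₃ - (starRingEnd ℂ) b₄) ≠ 0 := by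
    apply mul_ne_zero (sub_ne_zero.2 hne)
    rw [← map_sub]
    exact (map_ne_zero _).2 (sub_ne_zero.2 hne)
  have ht : (t:ℂ) * (1 - t) = 0 := (mul_eq_zero.1 key).resolve_right hne'
  rcases mul_eq_zero.1 ht with h | h
  · left; exact_mod_cast h
  · right
    have : (t:ℂ) = 1 := by linear_combination -h
    exact_mod_cast this

/-- The corrected-OR lemma assembled over `ℂ` (memo §8.4): from the two sign classes of the corrected slot,
`P·Q = −K·L` and `P·conj Q = −K·conj L` with `P ≠ 0`, one gets `Q·conj L = conj Q·L`, i.e. `Q conj L` is real. -/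
theorem corrected_or_real {P Q K L : ℂ} (hP : P ≠ 0)
    (h1 : P * Q = -(K * L)) (h2 : P * (starRingEnd ℂ) Q = -(K * (starRingEnd ℂ) L)) :
    Q * (starRingEnd ℂ) L = (starRingEnd ℂ) Q * L :=
  ratio_step hP h1 h2

theorem corrected_or_real' {P Q K L : ℂ} (hP : P ≠ 0)
    (h1 : P * Q = -(K * L)) (h2 : P * (starRingEnd ℂ) Q = -(K * (starRingEnd ℂ) L)) :
    (starRingEnd ℂ) (Q * (starRingEnd ℂ) L) = Q * (starRingEnd ℂ) L := by
  rw [map_mul, Complex.conj_conj, corrected_or_real hP h1 h2]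

end Transfer

end Summit.HodgeConjecture.HodgeConjecture.Cruxes.BlochSeedDiscOne.NoDesign16
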